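import Mathlib

/-!
# Route `SignedLowerHalves`, crux `KobayashiLowerHalfSemistable` (item stmt-BirchSwinnertonDyer-19000): the
# MODULE ALGEBRA of bstw-MEMO-12 (B1's proof memo) — the Kummer step (D2) §3 as «rational Manin–Drinfeld
# splitting + saturation», the idempotent exactness behind (D3)/(B1-b) §4, and the excluded-root step of
# (D1) §2(i) (cell `bsd-ssimc`, seat `bsd-ssimc-k3-c2` gen 14, object «KUMMER-SKELETON», planner ruling
# D24-8; a `--supports stmt-BirchSwinnertonDyer-19000 --as helper` file: closes nothing)

PARTITION (cell bsd-ssimc): X6 ∧ r = 0 (A6) × the 12 cells at `p = 3` + X6 r1 @ 3 + D2 literal @ 3 —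
types-the-object-of (the commutative algebra inside the cell's `p = 3` reading of Burungale–Skinner–Tian–Wan,
arXiv:2409.01350 (BSTW), Part I Thm. 1.3 on semistable curves: bstw-MEMO-12, which closes the residual B1 —
«the e′-ordinary cusps of `Y₁(D_L·p^r)` are unramified at `p`» and the ordinary filtration (O4a) of the FULL
cohomology at `p = 3` — at statement level); closes NONE; nothing booked. HONEST FRAMING: pure module algebra
(submodules, linear endomorphisms, idempotents over a commutative ring; Mathlib only, sorry-free); NOT (D1)
itself (Eisenstein series, the Eichler–Shimura relation, purity, Chebotarev have no tree vocabulary here), NOT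
Cais / EMI / Deligne's 1-motives / Manin–Drinfeld (they stay statement-level PRINT inputs of the memo), NOT a
binder, NO tier change; crux 2 kernel state p441716 (`KobayashiLowerHalfSemistable_of_tiersS_S3` ⟸ p441607's
binders) and the wording of record are untouched; nothing about modular curves, Hida families or elliptic
curves is asserted; BSD is not proved by any of this.

Source: `run/shared/lean/pub/bsd-ssimc/bstw-MEMO-12.md` (sha16 658adafc97caf8bd) §0 (D2), §2 (i), §3 (Kummer
argument, inputs (K1)–(K4)), §4 (B1-b); full dictionary in HOME/k3c2-MEMO-12.md. SYMBOLS (memo ↔ here), memo §3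
at level `r`, `σ ∈ I_p`: `𝓗_r = e′T_pMOT` ↔ `M` · `e′T_pJ` ↔ `A` (`TpJ`) · `𝓕⁺_r` ↔ `F` (`Fplus`), `F ≤ A` ·
`σ − 1` ↔ `φ` · the `e′`-Gysin projection `𝓗_r → e′C_r` ↔ `π` · (K3) Cais «`A⁻_r = A/F` is ℤ_p-free, `I_p`
trivial on it» ↔ `hK3`, `hK3free` · «`e′C_r = M/A` is ℤ_p-free» ↔ `hCfree` · (K2) Manin–Drinfeld AS USED (with
`m·u(ℤ[C]⁰) = 0`, the split 1-motive `[mY₀ →⁰ J] → [Y₀ → J]` puts a `G_ℚ`/Hecke-stable copy `Y` of `m·C_r`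
inside `T_pMOT`) ↔ the submodule `Y` with `hYstab`, `hYinj`, `hYidx` (or directly `hK2 : M/(A ⊔ Y)` torsion) ·
(K4) = (D1)(iii) «`I_p` trivial on `e′C_r`» ↔ `hD1 : π ∘ σ = π` (or, transported to `Y`, `σ = 1` on `Y`) ·
CONCLUSION of (D2) «`I_p` trivial on `𝓗_r/𝓕⁺_r`» ↔ `σ m - m ∈ F`. Memo §4: Gysin sequence with `e′` acting
compatibly ↔ `f, g, eA, eB, eC`, `f ∘ eA = eB ∘ f`, `g ∘ eB = eC ∘ g`. Memo §2(i): `F_ℓ` on `V_{η₁η₂}(−1)` with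
`F_ℓ² − T_ℓF_ℓ + ℓ⟨ℓ⟩ = 0`, `T_ℓ = a + b`, `ℓ⟨ℓ⟩ = ab` ↔ `hrel`; purity («weight 2 vs weight 0») ↔ `hwt`, `ha`.

KERNEL-CHECKED. §1 `saturated_of_tower`. §2 HEADLINE `map_mem_of_torsion_index` (any commutative ring:
`φ(A) ⊆ F`, `φ(Y) ⊆ F`, `M/(A ⊔ Y)` torsion, `M/F` torsion-free ⟹ `φ(M) ⊆ F`), `sub_mem_of_torsion_index`,
and the (D2)-lettered `sub_mem_of_cais_of_maninDrinfeld` — REPLACING the memo's `pⁿ`-level lifting and its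
prime-to-`p` step by «rational splitting + saturation» on the SAME inputs; §2a the inputs in the shape they
arrive: `eq_of_proj_fixed`, `torsion_index_of_split_copy`, `sub_mem_of_cais_of_maninDrinfeld'`; §2b NECESSITY
WITNESS `exists_witness_without_splitting` (`ℤ²`, `A = ℤ × 0`, `F = 0`, `φ(x, y) = (y, 0)`) = kernel form of
the memo's «without (K2) the argument fails». §3 `range_exact_of_idempotents`, `range_surjective_of_idempotents`,
`range_map_le_of_idempotents`. §4 `eq_smul_of_quadratic` (one root excluded ⟹ the other, as a scalar; no
semisimplicity needed), `eq_zero_of_norm_ne`, `eq_smul_of_quadratic_of_norm`. NOT typed: (D1)(ii) (`U_p`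
oldform blocks: polynomial identities), (1a)/(1b)/(1e), Frobenius on graded pieces, anything Λ-adic. Design:
THEOREMS ONLY; torsion(-freeness) spelled elementwise with `nonZeroDivisors R` (no quotient module is built).
-/

-- lint debt, justified: the Theorems namespace repeats the summit name (D-0017); `dupNamespace` flags every decl.
set_option linter.dupNamespace false

namespace Summit.BirchSwinnertonDyer.BirchSwinnertonDyer.Theorems.KummerSkeleton

section Saturation
variable {R : Type*} [CommRing R] {M : Type*} [AddCommGroup M] [Module R M]

/-! ## §1 The saturation tower -/

/-- **Tower.** `F ≤ A ≤ M`, `M/A` torsion-free (memo: «`e′C_r` is ℤ_p-free») and `A/F` torsion-free (Cais: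
«`A⁻_r` is ℤ_p-free») ⟹ `M/F` torsion-free (`𝓗_r/𝓕⁺_r`) — the saturation used by the headline. -/
theorem saturated_of_tower {F A : Submodule R M} (hFA : F ≤ A)
    (hA : ∀ (r : R) (m : M), r ∈ nonZeroDivisors R → r • m ∈ A → m ∈ A)
    (hF : ∀ (r : R) (a : M), r ∈ nonZeroDivisors R → a ∈ A → r • a ∈ F → a ∈ F)
    (r : R) (m : M) (hr : r ∈ nonZeroDivisors R) (hm : r • m ∈ F) : m ∈ F :=
  hF r m hr (hA r m hr (hFA hm)) hm

/-! ## §2 HEADLINE — the Kummer step (D2) as «rational splitting + saturation» -/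

/-- **HEADLINE (abstract form).** Any commutative ring `R`, `φ ∈ End M`, submodules `F, A, Y`: `φ(A) ⊆ F`
(`hA`), `φ(Y) ⊆ F` (`hY`), `M/(A ⊔ Y)` TORSION (`hidx`), `M/F` TORSION-FREE (`hsat`) ⟹ `φ(M) ⊆ F` (`r • m =
a + y` gives `r • φ m = φ a + φ y ∈ F`; saturation removes `r`). The whole of bstw-MEMO-12 §3 once (K3) ⟹ `hA` +
half of `hsat`, Gysin ⟹ the other half, (K2) Manin–Drinfeld ⟹ the split copy `Y` (`hidx`), (K4) ⟹ `hY`. -/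
theorem map_mem_of_torsion_index {F A Y : Submodule R M} (φ : M →ₗ[R] M)
    (hA : ∀ a ∈ A, φ a ∈ F) (hY : ∀ y ∈ Y, φ y ∈ F)
    (hidx : ∀ m : M, ∃ r ∈ nonZeroDivisors R, r • m ∈ A ⊔ Y)
    (hsat : ∀ (r : R) (m : M), r ∈ nonZeroDivisors R → r • m ∈ F → m ∈ F) (m : M) :
    φ m ∈ F := by
  obtain ⟨r, hr, hm⟩ := hidx m
  obtain ⟨a, ha, y, hy, hay⟩ := Submodule.mem_sup.mp hm
  refine hsat r (φ m) hr ?_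
  rw [← map_smul, ← hay, map_add]
  exact F.add_mem (hA a ha) (hY y hy)

/-- **HEADLINE, `σ`-form** (`φ = σ − 1`): `σ` trivial on `A` mod `F` and on `Y` mod `F`, `M/(A ⊔ Y)` torsion,
`M/F` torsion-free ⟹ `σ` trivial on `M` mod `F`. -/
theorem sub_mem_of_torsion_index {F A Y : Submodule R M} (σ : M →ₗ[R] M)
    (hA : ∀ a ∈ A, σ a - a ∈ F) (hY : ∀ y ∈ Y, σ y - y ∈ F)
    (hidx : ∀ m : M, ∃ r ∈ nonZeroDivisors R, r • m ∈ A ⊔ Y)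
    (hsat : ∀ (r : R) (m : M), r ∈ nonZeroDivisors R → r • m ∈ F → m ∈ F) (m : M) :
    σ m - m ∈ F := by
  have h := map_mem_of_torsion_index (F := F) (A := A) (Y := Y) (σ - LinearMap.id)
    (fun a ha => by simpa using hA a ha) (fun y hy => by simpa using hY y hy) hidx hsat m
  simpa using h

/-- **(D2) of bstw-MEMO-12, memo letters** (`M = 𝓗_r`, `TpJ = e′T_pJ ≥ Fplus = 𝓕⁺_r`, `σ ∈ I_p`, `Y` = the
`e′`-part of the Manin–Drinfeld-split copy of `m·ℤ_p[C]⁰`): (K3) Cais `hK3` + `hK3free`; Gysin `hCfree`; (K4) =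
(D1)(iii) on `Y` `hD1`; (K2) `hK2` ⟹ `I_p` trivial on `𝓗_r/𝓕⁺_r`. No `pⁿ`-level lifting, no prime-to-`p`
step: the memo's §3 bookkeeping is replaced by saturation — same inputs, same conclusion. -/
theorem sub_mem_of_cais_of_maninDrinfeld {Fplus TpJ Y : Submodule R M} (σ : M →ₗ[R] M)
    (hle : Fplus ≤ TpJ) (hK3 : ∀ a ∈ TpJ, σ a - a ∈ Fplus)
    (hK3free : ∀ (r : R) (a : M), r ∈ nonZeroDivisors R → a ∈ TpJ → r • a ∈ Fplus → a ∈ Fplus)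
    (hCfree : ∀ (r : R) (m : M), r ∈ nonZeroDivisors R → r • m ∈ TpJ → m ∈ TpJ) (hD1 : ∀ y ∈ Y, σ y = y)
    (hK2 : ∀ m : M, ∃ r ∈ nonZeroDivisors R, r • m ∈ TpJ ⊔ Y) (m : M) : σ m - m ∈ Fplus :=
  sub_mem_of_torsion_index σ hK3 (fun y hy => by simp [hD1 y hy]) hK2 (saturated_of_tower hle hCfree hK3free) m

/-! ### §2a The same with the cusp projection `π : 𝓗_r → e′C_r` explicit (inputs in the shape they arrive) -/

/-- **(K4) transported.** `π ∘ σ = π` ((D1)(iii) through the cusp projection), `Y` `σ`-stable, `π` injective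
on `Y` (the Manin–Drinfeld copy maps isomorphically onto `m·e′C_r`) ⟹ `σ` fixes `Y` pointwise. -/
theorem eq_of_proj_fixed {C : Type*} [AddCommGroup C] [Module R C] {Y : Submodule R M} (σ : M →ₗ[R] M)
    (π : M →ₗ[R] C) (hD1 : ∀ m : M, π (σ m) = π m) (hYstab : ∀ y ∈ Y, σ y ∈ Y)
    (hYinj : ∀ y ∈ Y, π y = 0 → y = 0) (y : M) (hy : y ∈ Y) : σ y = y := by
  have h0 : π (σ y - y) = 0 := by rw [map_sub, hD1, sub_self]
  exact sub_eq_zero.mp (hYinj _ (Y.sub_mem (hYstab y hy) hy) h0)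

/-- **(K2) as it is used.** `ker π ⊆ A` (`hAker`) and `π(Y) ⊇ r • C` for ONE non-zero-divisor `r` (`hYidx`:
`Y` maps onto `m·e′C_r`, `m·u(ℤ[C]⁰) = 0` by Manin–Drinfeld) ⟹ `r • m ∈ A ⊔ Y` for every `m`. -/
theorem torsion_index_of_split_copy {C : Type*} [AddCommGroup C] [Module R C] {A Y : Submodule R M}
    (π : M →ₗ[R] C) (hAker : ∀ m : M, π m = 0 → m ∈ A) {r : R} (hr : r ∈ nonZeroDivisors R)
    (hYidx : ∀ c : C, ∃ y ∈ Y, π y = r • c) (m : M) :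
    ∃ r ∈ nonZeroDivisors R, r • m ∈ A ⊔ Y := by
  obtain ⟨y, hy, hπy⟩ := hYidx (π m)
  have hker : r • m - y ∈ A := hAker _ (by rw [map_sub, map_smul, hπy, sub_self])
  exact ⟨r, hr, by simpa using Submodule.add_mem_sup hker hy⟩

/-- **(D2) with the cusp projection `π : 𝓗_r → e′C_r` explicit**: `ker π ⊆ TpJ` (`hAker`), (D1)(iii) `hD1`,
Manin–Drinfeld copy `Y` (`hYstab`, `hYinj`, `hYidx` for one non-zero-divisor `r`), Cais (`hK3`, `hK3free`),
Gysin (`hCfree`) ⟹ `σ` trivial on `𝓗_r/𝓕⁺_r`. -/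
theorem sub_mem_of_cais_of_maninDrinfeld' {C : Type*} [AddCommGroup C] [Module R C]
    {Fplus TpJ Y : Submodule R M} (σ : M →ₗ[R] M) (π : M →ₗ[R] C) (hle : Fplus ≤ TpJ)
    (hAker : ∀ m : M, π m = 0 → m ∈ TpJ) (hD1 : ∀ m : M, π (σ m) = π m)
    (hYstab : ∀ y ∈ Y, σ y ∈ Y) (hYinj : ∀ y ∈ Y, π y = 0 → y = 0)
    {r : R} (hr : r ∈ nonZeroDivisors R) (hYidx : ∀ c : C, ∃ y ∈ Y, π y = r • c)
    (hK3 : ∀ a ∈ TpJ, σ a - a ∈ Fplus)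
    (hK3free : ∀ (s : R) (a : M), s ∈ nonZeroDivisors R → a ∈ TpJ → s • a ∈ Fplus → a ∈ Fplus)
    (hCfree : ∀ (s : R) (m : M), s ∈ nonZeroDivisors R → s • m ∈ TpJ → m ∈ TpJ) (m : M) :
    σ m - m ∈ Fplus :=
  sub_mem_of_cais_of_maninDrinfeld σ hle hK3 hK3free hCfree
    (eq_of_proj_fixed σ π hD1 hYstab hYinj) (torsion_index_of_split_copy π hAker hr hYidx) m

/-! ## §2b NECESSITY of the splitting input (K2): «without Manin–Drinfeld the argument fails» -/

/-- **Necessity witness.** Headline hypotheses MINUS the split copy `Y` — even with `φ(M) ⊆ A` and both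
quotients torsion-free — do NOT give `φ(M) ⊆ F`: `M = ℤ × ℤ`, `A = ℤ × 0`, `F = 0`, `φ(x, y) = (y, 0)` (a
non-split extension of trivial by trivial: the Kummer class of a non-torsion point). Kernel form of bstw-MEMO-12
§3's bracket «without (K2) the argument fails … Manin–Drinfeld is load-bearing». -/
theorem exists_witness_without_splitting :
    ∃ (φ : ℤ × ℤ →ₗ[ℤ] ℤ × ℤ) (F A : Submodule ℤ (ℤ × ℤ)),
      F ≤ A ∧ (∀ a ∈ A, φ a ∈ F) ∧ (∀ m, φ m ∈ A) ∧
      (∀ (r : ℤ) (m : ℤ × ℤ), r ∈ nonZeroDivisors ℤ → r • m ∈ A → m ∈ A) ∧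
      (∀ (r : ℤ) (a : ℤ × ℤ), r ∈ nonZeroDivisors ℤ → a ∈ A → r • a ∈ F → a ∈ F) ∧
      ¬ (∀ m, φ m ∈ F) := by
  refine ⟨(LinearMap.inl ℤ ℤ ℤ).comp (LinearMap.snd ℤ ℤ ℤ), ⊥, Submodule.prod ⊤ ⊥, bot_le,
    ?_, ?_, ?_, ?_, ?_⟩
  · rintro ⟨x, y⟩ ha
    simp only [Submodule.mem_prod, Submodule.mem_top, Submodule.mem_bot, true_and] at ha
    simp [ha]
  · rintro ⟨x, y⟩
    simp [Submodule.mem_prod]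
  · rintro r ⟨x, y⟩ hr hm
    have hr0 : r ≠ 0 := nonZeroDivisors.ne_zero hr
    simp only [Submodule.mem_prod, Submodule.mem_top, Submodule.mem_bot, true_and, Prod.smul_mk,
      smul_eq_mul, mul_eq_zero] at hm ⊢
    exact hm.resolve_left hr0
  · rintro r ⟨x, y⟩ hr ha hF
    have hr0 : r ≠ 0 := nonZeroDivisors.ne_zero hr
    simp only [Submodule.mem_prod, Submodule.mem_top, Submodule.mem_bot, true_and, Prod.smul_mk,
      smul_eq_mul, Prod.mk_eq_zero, mul_eq_zero] at ha hF ⊢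
    exact ⟨hF.1.resolve_left hr0, ha⟩
  · intro h
    have h1 := h (0, 1)
    simp [Submodule.mem_bot] at h1

end Saturation

section Idempotents

/-! ## §3 (D3)/(B1-b): idempotents intertwining a short exact sequence -/

variable {R : Type*} [CommRing R] {A B C : Type*} [AddCommGroup A] [Module R A] [AddCommGroup B]
  [Module R B] [AddCommGroup C] [Module R C]

/-- **Middle exactness on the ranges.** `A →ᶠ B →ᵍ C` exact at `B`, `f ∘ eA = eB ∘ f`, `eB` idempotent ⟹
`range eB ∩ ker g ⊆ f(range eA)` (memo §4: `e′` on `0 → T_pJ_r → H¹(Y)(1) → ℤ_p[C]⁰ → 0`). -/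
theorem range_exact_of_idempotents (f : A →ₗ[R] B) (g : B →ₗ[R] C) (eA : A →ₗ[R] A) (eB : B →ₗ[R] B)
    (hfg : ∀ b : B, g b = 0 → ∃ a : A, f a = b) (hf : ∀ a : A, f (eA a) = eB (f a))
    (heB : ∀ b : B, eB (eB b) = eB b) (b : B) (hb : b ∈ LinearMap.range eB) (hgb : g b = 0) :
    ∃ a ∈ LinearMap.range eA, f a = b := by
  obtain ⟨a₀, rfl⟩ := hfg b hgb
  obtain ⟨b', hb'⟩ := hb
  refine ⟨eA a₀, ⟨a₀, rfl⟩, ?_⟩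
  rw [hf, ← hb', heB]

/-- **Right exactness on the ranges.** `g` onto and `g ∘ eB = eC ∘ g` ⟹ `g : range eB ↠ range eC`. -/
theorem range_surjective_of_idempotents (g : B →ₗ[R] C) (eB : B →ₗ[R] B) (eC : C →ₗ[R] C)
    (hg : Function.Surjective g) (hgc : ∀ b : B, g (eB b) = eC (g b)) (c : C)
    (hc : c ∈ LinearMap.range eC) : ∃ b ∈ LinearMap.range eB, g b = c := by
  obtain ⟨c', rfl⟩ := hc
  obtain ⟨b', rfl⟩ := hg c'
  exact ⟨eB b', ⟨b', rfl⟩, hgc b'⟩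

/-- **Stability** `f(range eA) ⊆ range eB` (left exactness on `range eA` is inherited from `f`). -/
theorem range_map_le_of_idempotents (f : A →ₗ[R] B) (eA : A →ₗ[R] A) (eB : B →ₗ[R] B)
    (hf : ∀ a : A, f (eA a) = eB (f a)) :
    (LinearMap.range eA).map f ≤ LinearMap.range eB := by
  rintro b ⟨a, ⟨a', rfl⟩, rfl⟩
  exact ⟨f a', (hf a').symm⟩

end Idempotents

section ExcludedRoot

/-! ## §4 (D1) §2(i): a quadratic relation with one root excluded -/

variable {K : Type*} [CommRing K] {V : Type*} [AddCommGroup V] [Module K V]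

/-- **Excluded root.** `F² − (a + b)F + ab = 0` on `V` (Eichler–Shimura on a label piece: `T_ℓ = a + b`,
`ℓ⟨ℓ⟩ = ab`) and `a` not an eigenvalue (`ha`) ⟹ `F = b` on `V` (`w := F v − b • v` has `F w = a • w`). -/
theorem eq_smul_of_quadratic (F : V →ₗ[K] V) (a b : K)
    (hrel : ∀ v : V, F (F v) - (a + b) • F v + (a * b) • v = 0)
    (ha : ∀ v : V, F v = a • v → v = 0) (v : V) : F v = b • v := by
  have key : F (F v - b • v) - a • (F v - b • v) = F (F v) - (a + b) • F v + (a * b) • v := by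
    simp only [map_sub, map_smul, smul_sub, add_smul, smul_smul]
    abel
  have hw : F (F v - b • v) = a • (F v - b • v) := sub_eq_zero.mp (key.trans (hrel v))
  exact sub_eq_zero.mp (ha _ hw)

end ExcludedRoot

section Weights

variable {K : Type*} [NormedField K] {V : Type*} [AddCommGroup V] [Module K V]

/-- **Weight exclusion.** Every eigenvalue `μ` of `F` has `‖μ‖ = w` («pure of weight 2») and `‖a‖ ≠ w`
(«`η₁(ℓ)` has weight 0») ⟹ `F v = a • v ⟹ v = 0`. -/
theorem eq_zero_of_norm_ne (F : V →ₗ[K] V) (a : K) (w : ℝ)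
    (hwt : ∀ μ : K, Module.End.HasEigenvalue F μ → ‖μ‖ = w) (ha : ‖a‖ ≠ w) (v : V)
    (hv : F v = a • v) : v = 0 := by
  by_contra h
  exact ha (hwt a (Module.End.hasEigenvalue_of_hasEigenvector
    ⟨Module.End.mem_eigenspace_iff.mpr hv, h⟩))

/-- **(D1) §2(i) assembled**: relation + purity + `‖a‖ ≠ w` ⟹ `F = b` («`F_ℓ = η₂(ℓ)ℓ` on `V_{η₁η₂}(−1)`»). -/
theorem eq_smul_of_quadratic_of_norm (F : V →ₗ[K] V) (a b : K) (w : ℝ)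
    (hrel : ∀ v : V, F (F v) - (a + b) • F v + (a * b) • v = 0)
    (hwt : ∀ μ : K, Module.End.HasEigenvalue F μ → ‖μ‖ = w) (ha : ‖a‖ ≠ w) (v : V) :
    F v = b • v :=
  eq_smul_of_quadratic F a b hrel (eq_zero_of_norm_ne F a w hwt ha) v

end Weights

end Summit.BirchSwinnertonDyer.BirchSwinnertonDyer.Theorems.KummerSkeleton
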